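import Summits.QuantumFields.YangMills.Theorems.BalabanUVNodesN15KingModelBoxFreeEnergyComparison
import Summits.QuantumFields.YangMills.Theorems.BalabanUVNodesN15KingModelLogSymbolFourierSigns
import HarnessLib

/-!
# BalabanUVNodes ∕ N15 — THE KING-MODEL RUNG (PART Ϟ-q): THE BOUNDARY-CONDITION SANDWICH — `|Ω|⁻¹ln det(c(−Δ_free)+m²)_Ω ≤ |T̂|⁻¹ln det(c(−Δ)+m²)_{T(2n)} ≤ f_∞` FOR EVERY BOX AND
# `|T(K)|⁻¹ln det ≤ f_∞` FOR EVERY TORUS (the periodic correction has a SIGN); dually `K_∞(0) ≤ G_T(x,x) ≤ G^Ω(s,s)` (every periodic variance lies above the infinite-volume one,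
# every free-boundary one above both) (Track A, DAG node N15 = NE2; FAN-OUT v1.1 §N15 s3 «KING-MODEL RUNG»; King (3.89)∕(4.4), §4 p.670 l.8–13; count-neutral)

HONEST FRAMING.  Count-neutral (cell `pub-ymgap`, seat `pub-ymgap-dag-n15-e` g41; `--supports stmt-QuantumFields-27366 --as helper` = K3⁸).  TEMPLATE LITERATURE: C. King, Commun. Math.
Phys. **102** (1986) 649–677 [King1986]: (2.17) p.653, (3.89)–(3.93) pp.668–669, (4.4) p.670, §4 p.670 l.8–13 («relating G on the torus to G on the whole lattice in the usual way»);
T. Bałaban, Commun. Math. Phys. **89** (1983) 571–597 [Balaban1983RegularityDecay]: (2.43) p.584.  Part Ϟ-n: `| |T(K)|⁻¹ln det − f_∞ | ≤ B_log·periodConst·e^{−(κ_F∕4)L}` (Poisson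
summation); part Ϟ-o: `f_Ω ≤ f_{T(2n)}` and `G_{T(2n)}(0,0) ≤ G^Ω(s,s)`; part Ϟ-p: `Re ĥ(z) ≤ 0` off the origin.  THIS FILE closes both sandwiches: §1 ★★★
**`log_det_lapF_div_card_le_freeEnergyInf`** (`|T(K)|⁻¹·ln det(c(−Δ)+m²)_{Πℤ∕K_μ} ≤ f_∞` for EVERY period vector: in Ϟ-n's Poisson identity the `m = 0` term is `f_∞` and every other term is
a log-kernel value off the origin, hence `≤ 0`), ★★★ **`log_det_boxOp_div_card_le_freeEnergyInf`** (with Ϟ-o: `|Ω|⁻¹ln det(c(−Δ_free)+m²)_Ω ≤ f_∞` for EVERY box), ★★ the ONE-SIDED forms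
of Ϟ-n's rates `0 ≤ f_∞ − |T|⁻¹ln det ≤ B_log·periodConst·e^{−(κ_F∕4)L}` (`freeEnergyInf_sub_log_det_lapF_div_card_le`) and `0 ≤ f_∞ − |Ω|⁻¹ln det_Ω ≤ 2BΣ_μ1∕n_μ + …`
(`freeEnergyInf_sub_log_det_boxOp_div_card_le`); §2 ★★ **`freeKer_le_lapF_inv`** (`K_∞(x̃−ỹ) ≤ G_T(x,y)`: Ε-b's periodisation `G_T(x,y) = Σ_mK_∞(x̃−ỹ+Km)` has non-negative terms by
Ε-f `freeKer_nonneg`), ★★ `freeKer_zero_le_lapF_inv_diag` (`K_∞(0) ≤ G_T(x,x)`), ★★ `freeKer_zero_le_kingBoxGreen_diag` (`K_∞(0) ≤ G^Ω(s,s)`); §3 ★★★ **`king_boundary_condition_sandwich`**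
(both chains by name: `f_Ω ≤ f_{T(2n)} ≤ f_∞` and `K_∞(0) ≤ G_{T(2n)}(0,0) ≤ G^Ω(s,s)`).

PRIOR TREE ART (named, USED not restated): Ϟ-p (`logKerC_re_nonpos`), Ϟ-n (`logKerC`, `logSymBound`, `norm_logKerC_le`, `logSymC_ofRealVec`, `logKerC_zero_re`, `torusMean_logSymC_eq_tsum`,
`sum_kingLogSym_dualMomentum_eq`, `abs_log_det_lapF_div_card_sub_freeEnergyInf_le`, `abs_log_det_boxOp_div_card_sub_freeEnergyInf_le`), Ϟ-o (`log_det_boxOp_div_card_le_dbl_torus`,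
`lapF_dbl_inv_diag_le_kingBoxGreen_diag`), Ε-b (`lapF_inv_eq_tsum_freeKer`, `summable_freeKer_translate`, `torRepZ`), Ε-f (`freeKer_nonneg`), Ε-k (`log_det_lapF`), Ε-m (`kingFreeEnergyInf`),
Ν-a′ (`kingBoxGreen`), Ϟ-c (`boxOp`), pv17 `B4TorusKernel` (`summable_of_decay`, `periodConst`, `MultiPeriod.translate_injective`), `B4TorusGreen244` (`dualMomentum`), `King1986` (`lapF`, `Tor`).
NOT Bałaban's covariant objects; NOT a node discharge (N15 is booked through n15-a's knit, untouched); nothing continuum-YM ∕ `ℝ⁴` ∕ OS ∕ Clay.  0 `sorry`; 0 `def`.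

HONEST SCOPE.  King's `A = 0` free operator, `c ≥ 0`, `m² > 0`, arbitrary period vectors `K_μ ≥ 1` and boxes `n_μ ≥ 1` (the comparison torus of a box is its doubled torus `Πℤ∕2n_μ`);
ONE-SIDED comparisons, strictness not claimed.  Locators: [King1986] (2.17) p.653, (3.89)–(3.93) pp.668–669, (4.4) p.670, §4 p.670 l.8–13; [Balaban1983RegularityDecay] (2.43) p.584.
-/

noncomputable section

open scoped BigOperators
open Finset Complex

namespace Summit.QuantumFields.YangMills.BalabanUVNodes.N15KingModelRung.TorusSpectral

open Literature.MathematicalPhysics.QuantumFieldTheory.Balaban1983to89.B5Prop11Plancherel (Tor)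
open Literature.MathematicalPhysics.QuantumFieldTheory.Balaban1983to89.B4Strip (ofRealVec)
open Literature.MathematicalPhysics.QuantumFieldTheory.Balaban1983to89.B4TorusKernel (periodConst summable_of_decay)
open Literature.MathematicalPhysics.QuantumFieldTheory.Balaban1983to89.B4TorusKernel.MultiPeriod (translate translate_apply translate_injective)
open Literature.MathematicalPhysics.QuantumFieldTheory.Balaban1983to89.B4TorusGreen244 (dualMomentum)
open Literature.MathematicalPhysics.QuantumFieldTheory.King1986.Torus

variable {d : ℕ}

/-! ## §1 Every periodic free energy density lies below the infinite-volume one; every free-boundary one below both -/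

section Density

variable {c m2 : ℝ}

/-- ★★★ **`|T(K)|⁻¹·ln det(c(−Δ)+m²)_{Πℤ∕K_μ} ≤ f_∞` FOR EVERY PERIOD VECTOR** (`c ≥ 0`, `m² > 0`): in Ϟ-n's Poisson identity the `m = 0` term is `f_∞` and every other term is a
log-kernel value off the origin, hence `≤ 0`. [cite: King1986, (3.89)–(3.93) pp.668–669, (4.4) p.670; Balaban1983RegularityDecay, (2.43) p.584] -/
theorem log_det_lapF_div_card_le_freeEnergyInf (K : Fin (d + 1) → ℕ) [hK : ∀ i, NeZero (K i)] (hc : 0 ≤ c) (hm : 0 < m2) :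
    (Fintype.card (Tor K) : ℝ)⁻¹ * Real.log (lapF K c m2).det ≤ kingFreeEnergyInf c m2 d := by
  have hK1 : ∀ i, 1 ≤ K i := fun i => NeZero.one_le
  have hcard : (Fintype.card (Tor K) : ℝ) = ∏ i, (K i : ℝ) := by
    rw [Fintype.card_pi]; push_cast; simp [ZMod.card]
  have hre : (Fintype.card (Tor K) : ℝ)⁻¹ * Real.log (lapF K c m2).det
      = ((∏ i, ((K i : ℕ) : ℂ))⁻¹ * ∑ k : (i : Fin (d + 1)) → Fin (K i), logSymC c m2 (ofRealVec (dualMomentum K k))).re := by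
    rw [log_det_lapF K hc hm, ← sum_kingLogSym_dualMomentum_eq K c m2, hcard]
    simp_rw [logSymC_ofRealVec hc hm]
    rw [← Complex.ofReal_sum]
    have e : (∏ i, ((K i : ℕ) : ℂ))⁻¹ = (((∏ i, (K i : ℝ))⁻¹ : ℝ) : ℂ) := by push_cast; rfl
    rw [e, ← Complex.ofReal_mul, Complex.ofReal_re]
  have hs : Summable fun m : Fin (d + 1) → ℤ => logKerC c m2 (translate K 0 m) :=
    (summable_of_decay (logKerC c m2) (kappaFree_pos hc hm d) (norm_logKerC_le hc hm)).comp_injective (translate_injective hK1 0)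
  have hsr : Summable fun m : Fin (d + 1) → ℤ => (logKerC c m2 (translate K 0 m)).re := (Complex.hasSum_re hs.hasSum).summable
  have h0 : translate K 0 0 = 0 := by funext i; simp
  rw [hre, torusMean_logSymC_eq_tsum K hc hm hK1, Complex.re_tsum hs, ← logKerC_zero_re hc hm]
  have key := hsr.neg.sum_le_tsum {0} fun m hm0 => by
    rw [Finset.mem_singleton] at hm0
    exact neg_nonneg.mpr (logKerC_re_nonpos hc hm fun h => hm0 (translate_injective hK1 0 (h.trans h0.symm)))
  rw [Finset.sum_singleton, tsum_neg, h0] at key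
  linarith

/-- ★★★ **`|Ω|⁻¹·ln det(c(−Δ_free)+m²)_Ω ≤ f_∞` FOR EVERY BOX** (Ϟ-o's comparison with the doubled torus, then the torus bound). [cite: King1986, (3.89) p.668, (4.4) p.670, §4 p.670 l.8–13] -/
theorem log_det_boxOp_div_card_le_freeEnergyInf (n : Fin (d + 1) → ℕ) [hn : ∀ μ, NeZero (n μ)] (hc : 0 ≤ c) (hm : 0 < m2) :
    (Fintype.card (KingBox n) : ℝ)⁻¹ * Real.log (boxOp n c m2).det ≤ kingFreeEnergyInf c m2 d :=
  (log_det_boxOp_div_card_le_dbl_torus n hc hm).trans (log_det_lapF_div_card_le_freeEnergyInf (dblPer n) hc hm)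

/-- ★★ the ONE-SIDED periodic rate: `0 ≤ f_∞ − |T(K)|⁻¹ln det ≤ B_log·periodConst(κ_F∕2)·e^{−(κ_F∕4)L}` (`K_μ ≥ L`). [cite: King1986, (3.89)–(3.93) pp.668–669, (4.4) p.670] -/
theorem freeEnergyInf_sub_log_det_lapF_div_card_le (K : Fin (d + 1) → ℕ) [hK : ∀ i, NeZero (K i)] (hc : 0 ≤ c) (hm : 0 < m2) {L : ℕ} (hL : ∀ i, L ≤ K i) :
    0 ≤ kingFreeEnergyInf c m2 d - (Fintype.card (Tor K) : ℝ)⁻¹ * Real.log (lapF K c m2).det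
    ∧ kingFreeEnergyInf c m2 d - (Fintype.card (Tor K) : ℝ)⁻¹ * Real.log (lapF K c m2).det
        ≤ logSymBound c m2 d * periodConst (kappaFree c m2 d / 2) d * Real.exp (-(kappaFree c m2 d / 4 * L)) := by
  refine ⟨sub_nonneg.mpr (log_det_lapF_div_card_le_freeEnergyInf K hc hm), ?_⟩
  have h := abs_log_det_lapF_div_card_sub_freeEnergyInf_le K hc hm hL
  rw [abs_sub_comm] at h
  exact (le_abs_self _).trans h

/-- ★★ the ONE-SIDED box rate: `0 ≤ f_∞ − |Ω|⁻¹ln det(c(−Δ_free)+m²)_Ω ≤ 2(|ln m²|+|ln(m²+4c(d+1))|)Σ_μ1∕n_μ + B_log·periodConst·e^{−(κ_F∕4)·2L}` (`n_μ ≥ L`).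
[cite: King1986, (3.89)–(3.93) pp.668–669, §4 p.670 l.8–13] -/
theorem freeEnergyInf_sub_log_det_boxOp_div_card_le (n : Fin (d + 1) → ℕ) [hn : ∀ μ, NeZero (n μ)] (hc : 0 ≤ c) (hm : 0 < m2) {L : ℕ} (hL : ∀ i, L ≤ n i) :
    0 ≤ kingFreeEnergyInf c m2 d - (Fintype.card (KingBox n) : ℝ)⁻¹ * Real.log (boxOp n c m2).det
    ∧ kingFreeEnergyInf c m2 d - (Fintype.card (KingBox n) : ℝ)⁻¹ * Real.log (boxOp n c m2).det
        ≤ 2 * (|Real.log m2| + |Real.log (m2 + 4 * c * (d + 1))|) * ∑ μ, ((n μ : ℝ))⁻¹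
          + logSymBound c m2 d * periodConst (kappaFree c m2 d / 2) d * Real.exp (-(kappaFree c m2 d / 4 * ((2 * L : ℕ) : ℝ))) := by
  refine ⟨sub_nonneg.mpr (log_det_boxOp_div_card_le_freeEnergyInf n hc hm), ?_⟩
  have h := abs_log_det_boxOp_div_card_sub_freeEnergyInf_le n hc hm hL
  rw [abs_sub_comm] at h
  exact (le_abs_self _).trans h

end Density

/-! ## §2 Every periodic variance lies above the infinite-volume one; every free-boundary one above both -/

section Variance

variable {c m2 : ℝ}

/-- ★★ **`K_∞(x̃ − ỹ) ≤ G_T(x,y)`**: the periodisation `G_T(x,y) = Σ_mK_∞(x̃−ỹ+Km)` (part Ε-b) has non-negative terms (part Ε-f). [cite: King1986, §4 p.670 l.8–13, (4.4) p.670;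
Balaban1983RegularityDecay, (2.43) p.584] -/
theorem freeKer_le_lapF_inv (K : Fin (d + 1) → ℕ) [hK : ∀ i, NeZero (K i)] (hc : 0 ≤ c) (hm : 0 < m2) (x y : Tor K) :
    freeKer c m2 (torRepZ K x - torRepZ K y) ≤ (lapF K c m2)⁻¹ x y := by
  rw [lapF_inv_eq_tsum_freeKer K hc hm x y]
  have h := (summable_freeKer_translate K hc hm (torRepZ K x - torRepZ K y)).sum_le_tsum {0} fun m _ => freeKer_nonneg hc hm _
  have h0 : translate K (torRepZ K x - torRepZ K y) 0 = torRepZ K x - torRepZ K y := by funext i; simp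
  rwa [Finset.sum_singleton, h0] at h

/-- ★★ **`K_∞(0) ≤ G_T(x,x)`** at every site of every torus. [cite: King1986, §4 p.670 l.8–13, (4.4) p.670] -/
theorem freeKer_zero_le_lapF_inv_diag (K : Fin (d + 1) → ℕ) [hK : ∀ i, NeZero (K i)] (hc : 0 ≤ c) (hm : 0 < m2) (x : Tor K) :
    freeKer c m2 (0 : Fin (d + 1) → ℤ) ≤ (lapF K c m2)⁻¹ x x := by
  simpa using freeKer_le_lapF_inv K hc hm x x

/-- ★★ **`K_∞(0) ≤ G^Ω(s,s)`** at every site of every box (through the doubled torus and Ϟ-o). [cite: King1986, (2.17) p.653, §4 p.670 l.8–13] -/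
theorem freeKer_zero_le_kingBoxGreen_diag (n : Fin (d + 1) → ℕ) [hn : ∀ μ, NeZero (n μ)] (hc : 0 ≤ c) (hm : 0 < m2) (s : KingBox n) :
    freeKer c m2 (0 : Fin (d + 1) → ℤ) ≤ kingBoxGreen n c m2 s s :=
  (freeKer_zero_le_lapF_inv_diag (dblPer n) hc hm 0).trans (lapF_dbl_inv_diag_le_kingBoxGreen_diag n hc hm s)

end Variance

/-! ## §3 The sandwich by name -/

section Sandwich

variable {c m2 : ℝ}

/-- ★★★ **THE BOUNDARY-CONDITION SANDWICH** for King's free covariances (`c ≥ 0`, `m² > 0`, every box `Ω = Π_μ{0,…,n_μ−1}`, its doubled torus `T(2n) = Πℤ∕2n_μ`, every site `s`):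
free energy densities `f_Ω ≤ f_{T(2n)} ≤ f_∞` and variances `K_∞(0) ≤ G_{T(2n)}(0,0) ≤ G^Ω(s,s)`. [cite: King1986, (2.17) p.653, (3.89)–(3.93) pp.668–669, (4.4) p.670, §4 p.670 l.8–13] -/
theorem king_boundary_condition_sandwich (n : Fin (d + 1) → ℕ) [hn : ∀ μ, NeZero (n μ)] (hc : 0 ≤ c) (hm : 0 < m2) (s : KingBox n) :
    ((Fintype.card (KingBox n) : ℝ)⁻¹ * Real.log (boxOp n c m2).det ≤ (Fintype.card (Tor (dblPer n)) : ℝ)⁻¹ * Real.log (lapF (dblPer n) c m2).det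
      ∧ (Fintype.card (Tor (dblPer n)) : ℝ)⁻¹ * Real.log (lapF (dblPer n) c m2).det ≤ kingFreeEnergyInf c m2 d)
    ∧ (freeKer c m2 (0 : Fin (d + 1) → ℤ) ≤ (lapF (dblPer n) c m2)⁻¹ 0 0 ∧ (lapF (dblPer n) c m2)⁻¹ 0 0 ≤ kingBoxGreen n c m2 s s) :=
  ⟨⟨log_det_boxOp_div_card_le_dbl_torus n hc hm, log_det_lapF_div_card_le_freeEnergyInf (dblPer n) hc hm⟩,
    ⟨freeKer_zero_le_lapF_inv_diag (dblPer n) hc hm 0, lapF_dbl_inv_diag_le_kingBoxGreen_diag n hc hm s⟩⟩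

end Sandwich

end Summit.QuantumFields.YangMills.BalabanUVNodes.N15KingModelRung.TorusSpectral

end
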